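import Literature.Geometry.DiscreteGeometry.ThreePointKernelGeneral
import Mathlib.Analysis.InnerProductSpace.GramMatrix
import Mathlib.Analysis.Matrix.PosDef
import Mathlib.LinearAlgebra.Matrix.Determinant.Basic
import HarnessLib

/-!
# The Bachoc–Vallentin three-point bound (Theorem 4.2) in every dimension `n ≥ 4`

Bachoc–Vallentin, *New upper bounds for kissing numbers from semidefinite programming* (J. AMS 21
(2008)), Theorem 4.2: any feasible solution of their semidefinite program gives an upper bound on
`A(n, θ)`, the maximal size of a spherical code in `S^{n-1}` with minimal angle `θ` (`cos θ = s`):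
with `a_1, …, a_d ≥ 0`, `(b₁₁ b₁₂; b₁₂ b₂₂) ⪰ 0`, `F_0, …, F_d ⪰ 0` and
* (i) `Σ_k a_k P_k^n(u) + 2 b₁₂ + b₂₂ + 3 Σ_k ⟨F_k, S_k^n(u,u,1)⟩ ≤ -1` for `u ∈ [-1, s]`,
* (ii) `b₂₂ + Σ_k ⟨F_k, S_k^n(u,v,t)⟩ ≤ 0` on
  `D' = {-1 ≤ u,v,t ≤ s, 1 + 2uvt - u² - v² - t² ≥ 0}`,
one has `A(n, θ) ≤ 1 + Σ_k a_k + b₁₁ + ⟨F_0, S_0^n(1,1,1)⟩`.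

This file proves the theorem for **all `n ≥ 4` and all `s`** (namespace
`Literature.Geometry.DiscreteGeometry.BachocVallentin`; the earlier `ThreePointBound` is the case
`n = 4`, `s = 1/2` on `E⁴`):
* `card_le_of_threePoint` — the abstract form: for a two-point function `A` with
  `Σ_{x,y ∈ C} A(x·y) ≥ 0`, a symmetric three-point function `F` with `Σ_{x,y,z ∈ C} F ≥ 0`, and
  `b` with `b₁₁ + 2b₁₂λ + b₂₂λ² ≥ 0`, conditions (i) `A(u) + 3F(u,u,1) ≤ -1 - 2b₁₂ - b₂₂` on `[-1,s]`
  and (ii) `F ≤ -b₂₂` on `D'` give `|C| ≤ 1 + A(1) + b₁₁ + F(1,1,1)` (BV §4 bookkeeping: split the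
  pair and triple sums by coincidences among `x, y, z`; Gram constraint `gram3_nonneg`);
* `threePointF` — the three-point function of a certificate in factored form,
  `F(u,v,t) = Σ_{k<K} Σ_{r<R} d_{k,r} · sym6 (g_{k,r}(u) g_{k,r}(v) Q n k (u,v,t))`, i.e.
  `6 Σ_k ⟨F_k, S_k^n⟩`-type sums with `F_k = Σ_r d_{k,r} w_{k,r} w_{k,r}ᵀ` (`d ≥ 0`, any basis
  polynomials folded into the weight functions `g_{k,r}`), its symmetry and
  `tripleSum_threePointF_nonneg` (from (pos S), `ThreePointKernelGeneral`);
* `card_le_of_certificate` / `card_le_of_certificate_int` — **Theorem 4.2** with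
  `A(u) = Σ_{k ≤ d} a_k C_k^{(n-2)/2}(u)` (`a_k ≥ 0`; unnormalised Gegenbauer polynomials, so the
  bound reads `1 + A(1) + b₁₁ + F(1,1,1)`) and `F = threePointF …`, and the integer form
  `|C| ≤ N` when the bound is `< N + 1`.
Positivity inputs: two-point `pairSum_gegenbauer_comb_nonneg` and three-point
`tripleSum_sym6_weight_nonneg` (both dimensions `n ≥ 4`, proved in the tree; no named-fact
hypothesis). Certificates (exact rational SDP solutions) discharge (i) and (ii) by
sums-of-squares identities in separate files.

## References
* C. Bachoc, F. Vallentin, *New upper bounds for kissing numbers from semidefinite programming*,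
  J. Amer. Math. Soc. 21 (2008) 909–924, §4, Theorem 4.2. [`BachocVallentin2007`]
-/

noncomputable section

open Finset
open scoped RealInnerProductSpace

namespace Literature.Geometry.DiscreteGeometry

namespace BachocVallentin

open Literature.Analysis.SpecialFunctions

variable {n : ℕ}

/-! ### The Gram constraint for three unit vectors -/

/-- For unit vectors `x, y, z` of `ℝⁿ`: `1 + 2(x·y)(x·z)(y·z) - (x·y)² - (x·z)² - (y·z)² ≥ 0`
(nonnegativity of the Gram determinant; the domain `D'`). [cite: BachocVallentin2007, §4 (4)] -/
theorem gram3_nonneg (x y z : EuclideanSpace ℝ (Fin n)) (hx : ‖x‖ = 1) (hy : ‖y‖ = 1)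
    (hz : ‖z‖ = 1) :
    0 ≤ 1 + 2 * inner ℝ x y * inner ℝ x z * inner ℝ y z - inner ℝ x y ^ 2 - inner ℝ x z ^ 2
      - inner ℝ y z ^ 2 := by
  classical
  have h := (Matrix.posSemidef_gram ℝ ![x, y, z]).det_nonneg
  rw [Matrix.det_fin_three] at h
  have hxx : inner ℝ x x = (1 : ℝ) := by rw [real_inner_self_eq_norm_sq, hx]; norm_num
  have hyy : inner ℝ y y = (1 : ℝ) := by rw [real_inner_self_eq_norm_sq, hy]; norm_num
  have hzz : inner ℝ z z = (1 : ℝ) := by rw [real_inner_self_eq_norm_sq, hz]; norm_num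
  simp only [Matrix.gram_apply, Matrix.cons_val_zero, Matrix.cons_val_one, Matrix.head_cons,
    Matrix.cons_val_two, Matrix.tail_cons, hxx, hyy, hzz] at h
  rw [real_inner_comm x y, real_inner_comm x z, real_inner_comm y z] at h
  nlinarith [h]

/-! ### The three-point inequality, abstract form -/

/-- **Bachoc–Vallentin, Theorem 4.2 (the bound from a feasible certificate), abstract form on
`S^{n-1}` for any angle:** if `C` is a finite set of unit vectors of `ℝⁿ` with pairwise inner
products `≤ s`, `A` satisfies `Σ_{x,y∈C} A(x·y) ≥ 0`, `F` is symmetric with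
`Σ_{x,y,z∈C} F(x·y,x·z,y·z) ≥ 0`, `b₁₁ + 2b₁₂λ + b₂₂λ² ≥ 0` for all `λ`,
(i) `A(u) + 3F(u,u,1) ≤ -1 - 2b₁₂ - b₂₂` for `u ∈ [-1,s]` and (ii) `F(u,v,t) ≤ -b₂₂` for
`u,v,t ∈ [-1,s]` with `1 + 2uvt - u² - v² - t² ≥ 0`, then `|C| ≤ 1 + A(1) + b₁₁ + F(1,1,1)`.
[cite: BachocVallentin2007, Theorem 4.2] -/
theorem card_le_of_threePoint (s : ℝ) (C : Finset (EuclideanSpace ℝ (Fin n)))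
    (hC : ∀ x ∈ C, ‖x‖ = 1) (hcode : ∀ x ∈ C, ∀ y ∈ C, x ≠ y → inner ℝ x y ≤ s)
    (A : ℝ → ℝ) (F : ℝ → ℝ → ℝ → ℝ) (b11 b12 b22 : ℝ)
    (hA : 0 ≤ pairSum C A) (hF : 0 ≤ tripleSum C F)
    (hF12 : ∀ u v t, F u v t = F v u t) (hF23 : ∀ u v t, F u v t = F u t v)
    (hb : ∀ l : ℝ, 0 ≤ b11 + 2 * b12 * l + b22 * l ^ 2)
    (h1 : ∀ u : ℝ, -1 ≤ u → u ≤ s → A u + 3 * F u u 1 ≤ -1 - 2 * b12 - b22)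
    (h2 : ∀ u v t : ℝ, -1 ≤ u → u ≤ s → -1 ≤ v → v ≤ s → -1 ≤ t → t ≤ s →
      0 ≤ 1 + 2 * u * v * t - u ^ 2 - v ^ 2 - t ^ 2 → F u v t ≤ -b22)
    (hpos : 0 ≤ 1 + A 1 + b11 + F 1 1 1) :
    (C.card : ℝ) ≤ 1 + A 1 + b11 + F 1 1 1 := by
  classical
  set M : ℝ := (C.card : ℝ) with hM
  by_cases hCe : C = ∅
  · simp [hM, hCe]; linarith
  obtain ⟨x0, hx0⟩ := Finset.nonempty_iff_ne_empty.2 hCe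
  have hMpos : (1 : ℝ) ≤ M := by
    rw [hM]; exact_mod_cast Finset.card_pos.2 ⟨x0, hx0⟩
  have hself : ∀ x ∈ C, inner ℝ x x = (1 : ℝ) := fun x hx => by
    rw [real_inner_self_eq_norm_sq, hC x hx]; norm_num
  -- range of inner products of distinct code points
  have hrange : ∀ x ∈ C, ∀ y ∈ C, x ≠ y → -1 ≤ inner ℝ x y ∧ inner ℝ x y ≤ s := by
    intro x hx y hy hxy
    refine ⟨?_, hcode x hx y hy hxy⟩
    have h := abs_real_inner_le_norm x y
    rw [hC x hx, hC y hy, mul_one] at h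
    exact (abs_le.1 h).1
  -- cardinalities of punctured sets
  have hcard1 : ∀ x ∈ C, ((C.erase x).card : ℝ) = M - 1 := by
    intro x hx
    rw [Finset.card_erase_of_mem hx, Nat.cast_sub (Finset.card_pos.2 ⟨x, hx⟩), hM]; simp
  have hcard2 : ∀ x ∈ C, ∀ y ∈ C.erase x, (((C.erase x).erase y).card : ℝ) = M - 2 := by
    intro x hx y hy
    have h2 : 2 ≤ C.card := by
      have : (C.erase x).card = C.card - 1 := Finset.card_erase_of_mem hx
      have hp : 0 < (C.erase x).card := Finset.card_pos.2 ⟨y, hy⟩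
      omega
    rw [Finset.card_erase_of_mem hy, Finset.card_erase_of_mem hx, Nat.sub_sub,
      Nat.cast_sub h2, hM]
    norm_num
  -- Step a: split the pair sum
  have hpair : pairSum C A = M * A 1 + ∑ x ∈ C, ∑ y ∈ C.erase x, A (inner ℝ x y) := by
    unfold pairSum
    rw [show M * A 1 = ∑ x ∈ C, A 1 by rw [Finset.sum_const, nsmul_eq_mul, hM],
      ← Finset.sum_add_distrib]
    refine Finset.sum_congr rfl fun x hx => ?_
    rw [← Finset.add_sum_erase C _ hx, hself x hx]
  -- Step a': split the triple sum
  have htriple : tripleSum C F = M * F 1 1 1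
      + 3 * ∑ x ∈ C, ∑ y ∈ C.erase x, F (inner ℝ x y) (inner ℝ x y) 1
      + ∑ x ∈ C, ∑ y ∈ C.erase x, ∑ z ∈ (C.erase x).erase y,
          F (inner ℝ x y) (inner ℝ x z) (inner ℝ y z) := by
    unfold tripleSum
    have hx_split : ∀ x ∈ C,
        (∑ y ∈ C, ∑ z ∈ C, F (inner ℝ x y) (inner ℝ x z) (inner ℝ y z)) =
          F 1 1 1 + 3 * ∑ y ∈ C.erase x, F (inner ℝ x y) (inner ℝ x y) 1 +
            ∑ y ∈ C.erase x, ∑ z ∈ (C.erase x).erase y,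
              F (inner ℝ x y) (inner ℝ x z) (inner ℝ y z) := by
      intro x hx
      rw [← Finset.add_sum_erase C _ hx]
      -- y = x term
      have hyx : (∑ z ∈ C, F (inner ℝ x x) (inner ℝ x z) (inner ℝ x z)) =
          F 1 1 1 + ∑ z ∈ C.erase x, F (inner ℝ x z) (inner ℝ x z) 1 := by
        rw [← Finset.add_sum_erase C _ hx, hself x hx]
        congr 1
        refine Finset.sum_congr rfl fun z _ => ?_
        rw [hF12, hF23]
      -- y ≠ x terms
      have hyne : ∀ y ∈ C.erase x,
          (∑ z ∈ C, F (inner ℝ x y) (inner ℝ x z) (inner ℝ y z)) =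
            2 * F (inner ℝ x y) (inner ℝ x y) 1 +
              ∑ z ∈ (C.erase x).erase y, F (inner ℝ x y) (inner ℝ x z) (inner ℝ y z) := by
        intro y hy
        have hyC : y ∈ C := Finset.mem_of_mem_erase hy
        rw [← Finset.add_sum_erase C _ hx, ← Finset.add_sum_erase (C.erase x) _ hy, hself x hx,
          hself y hyC, real_inner_comm x y]
        have e1 : F (inner ℝ x y) 1 (inner ℝ x y) = F (inner ℝ x y) (inner ℝ x y) 1 := by
          rw [hF23]
        rw [e1]; ring
      rw [hyx, Finset.sum_congr rfl hyne, Finset.sum_add_distrib, ← Finset.mul_sum]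
      ring
    rw [Finset.sum_congr rfl hx_split, Finset.sum_add_distrib, Finset.sum_add_distrib,
      Finset.sum_const, nsmul_eq_mul, ← hM, ← Finset.mul_sum]
  -- Step b: bound the pair terms
  have hb2 : (∑ x ∈ C, ∑ y ∈ C.erase x, (A (inner ℝ x y) + 3 * F (inner ℝ x y) (inner ℝ x y) 1))
      ≤ M * (M - 1) * (-1 - 2 * b12 - b22) := by
    have : ∀ x ∈ C, (∑ y ∈ C.erase x, (A (inner ℝ x y) + 3 * F (inner ℝ x y) (inner ℝ x y) 1))
        ≤ (M - 1) * (-1 - 2 * b12 - b22) := by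
      intro x hx
      rw [← hcard1 x hx]
      have h := Finset.sum_le_card_nsmul (C.erase x)
        (fun y => A (inner ℝ x y) + 3 * F (inner ℝ x y) (inner ℝ x y) 1) (-1 - 2 * b12 - b22)
        (fun y hy => by
          have hyC : y ∈ C := Finset.mem_of_mem_erase hy
          have hxy : x ≠ y := fun h => (Finset.ne_of_mem_erase hy) h.symm
          obtain ⟨lo, hi⟩ := hrange x hx y hyC hxy
          exact h1 _ lo hi)
      rwa [nsmul_eq_mul] at h
    calc (∑ x ∈ C, ∑ y ∈ C.erase x, (A (inner ℝ x y) + 3 * F (inner ℝ x y) (inner ℝ x y) 1))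
        ≤ ∑ x ∈ C, (M - 1) * (-1 - 2 * b12 - b22) := Finset.sum_le_sum this
      _ = M * (M - 1) * (-1 - 2 * b12 - b22) := by
        rw [Finset.sum_const, nsmul_eq_mul, ← hM]; ring
  -- Step c: bound the distinct-triple terms
  have hc3 : (∑ x ∈ C, ∑ y ∈ C.erase x, ∑ z ∈ (C.erase x).erase y,
      F (inner ℝ x y) (inner ℝ x z) (inner ℝ y z)) ≤ M * (M - 1) * (M - 2) * (-b22) := by
    have hin : ∀ x ∈ C, ∀ y ∈ C.erase x,
        (∑ z ∈ (C.erase x).erase y, F (inner ℝ x y) (inner ℝ x z) (inner ℝ y z))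
          ≤ (M - 2) * (-b22) := by
      intro x hx y hy
      rw [← hcard2 x hx y hy]
      have hyC : y ∈ C := Finset.mem_of_mem_erase hy
      have hxy : x ≠ y := fun h => (Finset.ne_of_mem_erase hy) h.symm
      have h := Finset.sum_le_card_nsmul ((C.erase x).erase y)
        (fun z => F (inner ℝ x y) (inner ℝ x z) (inner ℝ y z)) (-b22)
        (fun z hz => by
          have hz1 : z ∈ C.erase x := Finset.mem_of_mem_erase hz
          have hzC : z ∈ C := Finset.mem_of_mem_erase hz1
          have hzy : z ≠ y := Finset.ne_of_mem_erase hz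
          have hzx : z ≠ x := Finset.ne_of_mem_erase hz1
          obtain ⟨lo1, hi1⟩ := hrange x hx y hyC hxy
          obtain ⟨lo2, hi2⟩ := hrange x hx z hzC hzx.symm
          obtain ⟨lo3, hi3⟩ := hrange y hyC z hzC hzy.symm
          exact h2 _ _ _ lo1 hi1 lo2 hi2 lo3 hi3
            (gram3_nonneg x y z (hC x hx) (hC y hyC) (hC z hzC)))
      rwa [nsmul_eq_mul] at h
    have hmid : ∀ x ∈ C, (∑ y ∈ C.erase x, ∑ z ∈ (C.erase x).erase y,
        F (inner ℝ x y) (inner ℝ x z) (inner ℝ y z)) ≤ (M - 1) * ((M - 2) * (-b22)) := by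
      intro x hx
      rw [← hcard1 x hx]
      have h := Finset.sum_le_card_nsmul (C.erase x)
        (fun y => ∑ z ∈ (C.erase x).erase y, F (inner ℝ x y) (inner ℝ x z) (inner ℝ y z))
        ((M - 2) * (-b22)) (fun y hy => hin x hx y hy)
      rwa [nsmul_eq_mul] at h
    calc (∑ x ∈ C, ∑ y ∈ C.erase x, ∑ z ∈ (C.erase x).erase y,
          F (inner ℝ x y) (inner ℝ x z) (inner ℝ y z))
        ≤ ∑ x ∈ C, (M - 1) * ((M - 2) * (-b22)) := Finset.sum_le_sum hmid
      _ = M * (M - 1) * (M - 2) * (-b22) := by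
        rw [Finset.sum_const, nsmul_eq_mul, ← hM]; ring
  -- Step d: combine
  have hsum : 0 ≤ M * (A 1 + F 1 1 1) + M * (M - 1) * (-1 - 2 * b12 - b22)
      + M * (M - 1) * (M - 2) * (-b22) := by
    have htot : pairSum C A + tripleSum C F = M * (A 1 + F 1 1 1)
        + (∑ x ∈ C, ∑ y ∈ C.erase x, (A (inner ℝ x y) + 3 * F (inner ℝ x y) (inner ℝ x y) 1))
        + ∑ x ∈ C, ∑ y ∈ C.erase x, ∑ z ∈ (C.erase x).erase y,
            F (inner ℝ x y) (inner ℝ x z) (inner ℝ y z) := by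
      rw [hpair, htriple]
      simp only [Finset.sum_add_distrib, Finset.mul_sum]
      ring
    nlinarith [hA, hF, hb2, hc3, htot]
  have hquad := hb (M - 1)
  -- divide by M ≥ 1
  have hM0 : 0 < M := by linarith
  have key : 0 ≤ (A 1 + F 1 1 1) + (M - 1) * (-1 - 2 * b12 - b22) + (M - 1) * (M - 2) * (-b22) := by
    have := div_nonneg hsum hM0.le
    have e : (M * (A 1 + F 1 1 1) + M * (M - 1) * (-1 - 2 * b12 - b22)
        + M * (M - 1) * (M - 2) * (-b22)) / M
        = (A 1 + F 1 1 1) + (M - 1) * (-1 - 2 * b12 - b22) + (M - 1) * (M - 2) * (-b22) := by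
      field_simp
    linarith [this, e.symm.le, e.le]
  nlinarith [key, hquad]

/-! ### The three-point function of a certificate -/

/-- The three-point function of a certificate in factored form:
`F(u,v,t) = Σ_{k<K} Σ_{r<R} d_{k,r} · sym6 (g_{k,r}(u) g_{k,r}(v) Q n k (u,v,t))`, which is
`6 Σ_k ⟨F_k, S_k^n(u,v,t)⟩` for `F_k = Σ_r d_{k,r} w_{k,r} w_{k,r}ᵀ` when `g_{k,r}(u) = Σ_i (w_{k,r})_i
P_i(u)` in the basis `P_i` used for `Y_k^n` (Theorem 3.2 / Remark 3.4), up to the positive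
normalisations of `Q` and of the factor `6`. [cite: BachocVallentin2007, Theorem 4.2 (the function Σ_k ⟨F_k, S_k^n⟩)] -/
def threePointF (n K R : ℕ) (d : ℕ → ℕ → ℝ) (g : ℕ → ℕ → ℝ → ℝ) (u v t : ℝ) : ℝ :=
  ∑ k ∈ range K, ∑ r ∈ range R, d k r * sym6 (fun u v t => g k r u * g k r v * Q n k u v t) u v t

/-- `threePointF` is symmetric in its first two arguments.
[cite: BachocVallentin2007, Corollary 3.5 (S_k^n symmetric)] -/
theorem threePointF_swap12 (n K R : ℕ) (d : ℕ → ℕ → ℝ) (g : ℕ → ℕ → ℝ → ℝ) (u v t : ℝ) :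
    threePointF n K R d g u v t = threePointF n K R d g v u t := by
  unfold threePointF
  refine Finset.sum_congr rfl fun k _ => Finset.sum_congr rfl fun r _ => ?_
  rw [sym6_swap12]

/-- `threePointF` is symmetric in its last two arguments.
[cite: BachocVallentin2007, Corollary 3.5 (S_k^n symmetric)] -/
theorem threePointF_swap23 (n K R : ℕ) (d : ℕ → ℕ → ℝ) (g : ℕ → ℕ → ℝ → ℝ) (u v t : ℝ) :
    threePointF n K R d g u v t = threePointF n K R d g u t v := by
  unfold threePointF
  refine Finset.sum_congr rfl fun k _ => Finset.sum_congr rfl fun r _ => ?_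
  rw [sym6_swap23]

/-- **(pos S) for a certificate's three-point function:** `Σ_{x,y,z ∈ C} F(x·y, x·z, y·z) ≥ 0` for
`F = threePointF n K R d g` with `d ≥ 0`, `C ⊂ S^{n-1}` finite, `n ≥ 4`.
[cite: BachocVallentin2007, Corollary 3.5] -/
theorem tripleSum_threePointF_nonneg (hn : 4 ≤ n) (K R : ℕ) (d : ℕ → ℕ → ℝ)
    (hd : ∀ k r, 0 ≤ d k r) (g : ℕ → ℕ → ℝ → ℝ) (C : Finset (EuclideanSpace ℝ (Fin n)))
    (hC : ∀ x ∈ C, ‖x‖ = 1) :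
    0 ≤ tripleSum C (threePointF n K R d g) := by
  unfold threePointF
  rw [tripleSum_finset_sum]
  refine Finset.sum_nonneg fun k _ => ?_
  rw [tripleSum_finset_sum]
  refine Finset.sum_nonneg fun r _ => ?_
  rw [tripleSum_smul]
  exact mul_nonneg (hd k r) (tripleSum_sym6_weight_nonneg hn k (g k r) C hC)

/-! ### Theorem 4.2 for certificates -/

/-- `b₁₁, b₂₂ ≥ 0` and `b₁₂² ≤ b₁₁ b₂₂` (i.e. `(b₁₁ b₁₂; b₁₂ b₂₂) ⪰ 0`) give
`b₁₁ + 2 b₁₂ λ + b₂₂ λ² ≥ 0` for all `λ`. [cite: BachocVallentin2007, Theorem 4.2 (the block (b₁₁ b₁₂; b₁₂ b₂₂) ⪰ 0)] -/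
theorem quad_nonneg_of_psd2 (b11 b12 b22 : ℝ) (hb11 : 0 ≤ b11) (hb22 : 0 ≤ b22)
    (hdet : b12 ^ 2 ≤ b11 * b22) (l : ℝ) : 0 ≤ b11 + 2 * b12 * l + b22 * l ^ 2 := by
  rcases hb22.eq_or_lt with h0 | hpos
  · have hb12 : b12 = 0 := by
      rw [← h0, mul_zero] at hdet
      exact pow_eq_zero_iff (n := 2) (by norm_num) |>.1 (le_antisymm hdet (sq_nonneg _))
    rw [← h0, hb12]; simpa using hb11
  · have h : 0 ≤ b22 * (b11 + 2 * b12 * l + b22 * l ^ 2) := by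
      nlinarith [sq_nonneg (b12 + b22 * l)]
    exact nonneg_of_mul_nonneg_right h hpos

/-- **Bachoc–Vallentin, Theorem 4.2, every dimension `n ≥ 4` and every angle:** let `C` be a
finite set of unit vectors of `ℝⁿ` with pairwise inner products `≤ s`; let `a_0, …, a_d ≥ 0`,
`A(u) = Σ_{k ≤ d} a_k C_k^{(n-2)/2}(u)`; let `F = threePointF n K R d g` with coefficients
`d_{k,r} ≥ 0` (`= 6 Σ_k ⟨F_k, S_k^n⟩` with `F_k ⪰ 0` in factored form); let `b₁₁, b₂₂ ≥ 0`,
`b₁₂² ≤ b₁₁ b₂₂`. If (i) `A(u) + 3F(u,u,1) ≤ -1 - 2b₁₂ - b₂₂` on `[-1, s]` and (ii)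
`F(u,v,t) ≤ -b₂₂` on `D'`, then `|C| ≤ 1 + A(1) + b₁₁ + F(1,1,1)`.
[cite: BachocVallentin2007, Theorem 4.2] -/
theorem card_le_of_certificate (hn : 4 ≤ n) (s : ℝ) (C : Finset (EuclideanSpace ℝ (Fin n)))
    (hC : ∀ x ∈ C, ‖x‖ = 1) (hcode : ∀ x ∈ C, ∀ y ∈ C, x ≠ y → inner ℝ x y ≤ s)
    (deg : ℕ) (a : ℕ → ℝ) (ha : ∀ k, 0 ≤ a k)
    (K R : ℕ) (d : ℕ → ℕ → ℝ) (hd : ∀ k r, 0 ≤ d k r) (g : ℕ → ℕ → ℝ → ℝ)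
    (b11 b12 b22 : ℝ) (hb11 : 0 ≤ b11) (hb22 : 0 ≤ b22) (hdet : b12 ^ 2 ≤ b11 * b22)
    (h1 : ∀ u : ℝ, -1 ≤ u → u ≤ s →
      (∑ k ∈ range (deg + 1), a k * gegenbauerSum (((n : ℝ) - 2) / 2) k u)
        + 3 * threePointF n K R d g u u 1 ≤ -1 - 2 * b12 - b22)
    (h2 : ∀ u v t : ℝ, -1 ≤ u → u ≤ s → -1 ≤ v → v ≤ s → -1 ≤ t → t ≤ s →
      0 ≤ 1 + 2 * u * v * t - u ^ 2 - v ^ 2 - t ^ 2 → threePointF n K R d g u v t ≤ -b22)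
    (hpos : 0 ≤ 1 + (∑ k ∈ range (deg + 1), a k * gegenbauerSum (((n : ℝ) - 2) / 2) k 1)
      + b11 + threePointF n K R d g 1 1 1) :
    (C.card : ℝ) ≤ 1 + (∑ k ∈ range (deg + 1), a k * gegenbauerSum (((n : ℝ) - 2) / 2) k 1)
      + b11 + threePointF n K R d g 1 1 1 :=
  card_le_of_threePoint s C hC hcode
    (fun u => ∑ k ∈ range (deg + 1), a k * gegenbauerSum (((n : ℝ) - 2) / 2) k u)
    (threePointF n K R d g) b11 b12 b22
    (pairSum_gegenbauer_comb_nonneg (by omega) deg a ha C hC)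
    (tripleSum_threePointF_nonneg hn K R d hd g C hC)
    (fun u v t => threePointF_swap12 n K R d g u v t)
    (fun u v t => threePointF_swap23 n K R d g u v t)
    (quad_nonneg_of_psd2 b11 b12 b22 hb11 hb22 hdet) h1 h2 hpos

/-- **Integer form of Theorem 4.2:** under the hypotheses of `card_le_of_certificate`, if the
bound `1 + A(1) + b₁₁ + F(1,1,1)` is `< N + 1` then `|C| ≤ N`; in particular `A(n, arccos s) ≤ N`,
and for `s = 1/2` the kissing number of dimension `n` is at most `N`.
[cite: BachocVallentin2007, Theorem 4.2] -/
theorem card_le_of_certificate_int (hn : 4 ≤ n) (s : ℝ) (C : Finset (EuclideanSpace ℝ (Fin n)))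
    (hC : ∀ x ∈ C, ‖x‖ = 1) (hcode : ∀ x ∈ C, ∀ y ∈ C, x ≠ y → inner ℝ x y ≤ s)
    (deg : ℕ) (a : ℕ → ℝ) (ha : ∀ k, 0 ≤ a k)
    (K R : ℕ) (d : ℕ → ℕ → ℝ) (hd : ∀ k r, 0 ≤ d k r) (g : ℕ → ℕ → ℝ → ℝ)
    (b11 b12 b22 : ℝ) (hb11 : 0 ≤ b11) (hb22 : 0 ≤ b22) (hdet : b12 ^ 2 ≤ b11 * b22)
    (h1 : ∀ u : ℝ, -1 ≤ u → u ≤ s →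
      (∑ k ∈ range (deg + 1), a k * gegenbauerSum (((n : ℝ) - 2) / 2) k u)
        + 3 * threePointF n K R d g u u 1 ≤ -1 - 2 * b12 - b22)
    (h2 : ∀ u v t : ℝ, -1 ≤ u → u ≤ s → -1 ≤ v → v ≤ s → -1 ≤ t → t ≤ s →
      0 ≤ 1 + 2 * u * v * t - u ^ 2 - v ^ 2 - t ^ 2 → threePointF n K R d g u v t ≤ -b22)
    (N : ℕ) (hN0 : 0 ≤ 1 + (∑ k ∈ range (deg + 1), a k * gegenbauerSum (((n : ℝ) - 2) / 2) k 1)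
      + b11 + threePointF n K R d g 1 1 1)
    (hN : 1 + (∑ k ∈ range (deg + 1), a k * gegenbauerSum (((n : ℝ) - 2) / 2) k 1)
      + b11 + threePointF n K R d g 1 1 1 < (N : ℝ) + 1) :
    C.card ≤ N := by
  have h := card_le_of_certificate hn s C hC hcode deg a ha K R d hd g b11 b12 b22 hb11 hb22 hdet
    h1 h2 hN0
  have hlt : (C.card : ℝ) < (N : ℝ) + 1 := lt_of_le_of_lt h hN
  have hlt' : C.card < N + 1 := by exact_mod_cast hlt
  omega

end BachocVallentin

end Literature.Geometry.DiscreteGeometry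

end
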